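import Literature.NumberTheory.Automorphic.LanglandsTunnellLSeriesProofs
import Literature.NumberTheory.Automorphic.DeligneSerreThm46bHolds
import HarnessLib

/-!
# Discharged fact: `L(s, ρ_f) = L(s, f)` on `re s > 1` for a weight-one newform and its Deligne–Serre
# representation (Deligne–Serre 1974, Thm. 4.1 with Thm. 4.6 (b))

`Literature.NumberTheory.Automorphic.artinLFunction_eq_cuspFormLSeries`
(`Automorphic/LanglandsTunnell`, section `Comparison`: for a weight-one newform `f` on `Γ₁(N)` and a
framed Artin representation `ρ` which is the Galois representation of `f` away from `N`, the Artin
`L`-function of `ρ` equals the `L`-series of `f` on `re s > 1`) was reduced in the tree to the single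
local input of Deligne–Serre 1974, Thm. 4.6 (b) at the primes dividing the level, in per-place form
(`deligneSerre_eulerFactorAt_eq_of_dvd_level`), by `artinLFunction_eq_cuspFormLSeries_of_hecke'`
(`Automorphic/LanglandsTunnellLSeriesProofs`; the Hecke relations of Part D and the Euler product
being proved).  That input is a theorem of the tree (`deligneSerre_eulerFactorAt_eq_of_dvd_level_holds`,
`Automorphic/DeligneSerreThm46bHolds`), so the fact is discharged by the one-line application below,
with the fact's own implicit parameters `N`, `f`, `ρ`.  No statement is changed; no definition, no new
named fact (D-0026); net Literature debt **−1**.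

## References

* P. Deligne, J.-P. Serre, *Formes modulaires de poids 1*, Ann. Sci. ÉNS (4) 7 (1974) 507–530:
  Thm. 4.1, Thm. 4.6 (b) (with proof step (iii)), Cor. 4.2. [DeligneSerreASENS1974]
* F. Diamond, J. Shurman, *A First Course in Modular Forms*, GTM 228 (2005), §9.6. [DiamondShurman2005]
-/

noncomputable section

namespace Literature.NumberTheory.Automorphic

open scoped MatrixGroups ModularForm NumberField
open CongruenceSubgroup
open EllipticCurves.ModularForms ModularForms

variable {N : ℕ} [NeZero N] {f : CuspForm (Gamma1 N) 1} {ρ : GaloisRepresentations.FramedArtinRep ℚ 2}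

/-- **Deligne–Serre 1974, Thm. 4.1 with Thm. 4.6 (b): `L(s, ρ) = L(s, f)` on `re s > 1` — the named
fact `artinLFunction_eq_cuspFormLSeries` holds** (for every level `N`, weight-one cusp form `f` and
framed Artin representation `ρ`, the fact's implicit parameters):
`artinLFunction_eq_cuspFormLSeries_of_hecke'` applied to `deligneSerre_eulerFactorAt_eq_of_dvd_level_holds`.
[cite: DeligneSerreASENS1974, Thm. 4.1 and Thm. 4.6 (b)] -/
theorem artinLFunction_eq_cuspFormLSeries_holds : artinLFunction_eq_cuspFormLSeries (f := f) (ρ := ρ) :=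
  artinLFunction_eq_cuspFormLSeries_of_hecke' deligneSerre_eulerFactorAt_eq_of_dvd_level_holds

end Literature.NumberTheory.Automorphic

end
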